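import Summits.Ventures.LatticeQCDFlow.Scaling.HubChainPersistenceForm

/-!
HONEST FRAMING: exact (Metropolis-corrected) sampling algorithms for lattice gauge theory; figures
of merit are autocorrelation/cost numbers at stated couplings and volumes; no continuum-physics
claim.

# HubChainShallowTagDomination — A SECOND PER-STEP CASE OF CONJECTURE M′: AT EVERY TARGET DEEPER THAN THE TAGGED PARTICLE WHOSE EIGENVALUE IS NON-NEGATIVE, RAISING THE TAG'S DEPTH
# LOWERS THE `n`-STEP TRANSITION PROBABILITIES FOR ALL `n` — DIAGONAL INCLUDED (lean-2 GEN-39, ours)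

Venture-side (OURS).  Cell `lqcd-flow` (pub-lqcd), unit `pub-lqcd-lean-2-g39`, 2026-08-30.  Chapter Y, file 10.  Setting of files 1–2 and 9 for TWO depth profiles `ρ^X ≤ ρ^Y` agreeing off one
rank `s` (the tagged particle ★; `ρ^X_s ≤ ρ^Y_s`, both profiles non-decreasing).  By the persistence form of file 9, for a target rank `j > s`:
`T_n(j) = c·Σ_{j<k<m}(1/ρ_{k−1} − 1/ρ_k)H_n(β_k,β_{k−1}) + (c/ρ_{m−1})H_n(1,β_{m−1})` involves only depths at ranks `≥ j > s` (the same for `X` and `Y`) and eigenvalues `β_k`, `k ≥ j`,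
each of which is SMALLER for `Y` (`R^Y_k = R^X_k + (ρ^Y_s − ρ^X_s)`); `H_n` is non-decreasing in each argument on `[0,∞)²`.  Hence:

* **`shallowTag_T_le`**: if `s < j < m` and `β^Y_j ≥ 0` then `T^Y_n(j) ≤ T^X_n(j)` for every `n`;
* **`shallowTag_pow_le`**: for `i, j ≠ s` with `max(i,j) > s` and `β^Y_{max(i,j)} ≥ 0`: `P_Yⁿ(i,j) ≤ P_Xⁿ(i,j)` for every `n` (diagonal included: `0 ≤ β^Y_j ≤ β^X_j`).

With file 6 (★ deepest: every target, no sign condition) and file 5 (★ shallowest, start at the next rank: the diagonal FAILS at `n = 2`; there `β_z < 0`), the typed picture of Conjecture M′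
is: per-step domination holds at deep targets with non-negative eigenvalue and everywhere when ★ is deepest; the sign condition is where the self-exclusion's negative eigenvalues
(`β_1 = −cρ_0/ρ_1 < 0` always) can bite, and on the diagonal they do.  TOY (`numerics/mprime_cases.py`, NOTHING CLAIMED): off the diagonal 0 ∕ 25 452 violations in all positions;
on the diagonal the violations sit at starts deeper than ★ (101 ∕ 4 676) and at the shallowest rank (7 ∕ 4 354, all `j = 0`).

Literature grade (cell rule): OWN, elementary; nothing cited; no new bib keys.
-/

open Finset

namespace Summit.Ventures.LatticeQCDFlow.Scaling

section ShallowTag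
variable {m s : ℕ} {ρX ρY RX RY βX βY : ℕ → ℝ} {c : ℝ} {PX PY fX fY : ℕ → ℕ → ℝ} {PnX PnY : ℕ → ℕ → ℕ → ℝ} {TX TY : ℕ → ℕ → ℝ}

/-- **`T^Y_n(j) ≤ T^X_n(j)` at a target `j` deeper than the tag with `β^Y_j ≥ 0`.** [ours] -/
theorem shallowTag_T_le (hρX : ∀ i, 0 < ρX i) (hmonoX : Monotone ρX) (hρY : ∀ i, 0 < ρY i) (hmonoY : Monotone ρY)
    (hagree : ∀ i, i ≠ s → ρX i = ρY i) (htag : ρX s ≤ ρY s)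
    (hRX : ∀ k, RX k = ∑ i ∈ range k, ρX i) (hRY : ∀ k, RY k = ∑ i ∈ range k, ρY i)
    (hβX : ∀ k, βX k = 1 - c * (((m - k : ℕ) : ℝ) + RX k / ρX k)) (hβY : ∀ k, βY k = 1 - c * (((m - k : ℕ) : ℝ) + RY k / ρY k))
    (hTX : ∀ n j, TX n j = (1 - βX j ^ n) / RX m + ∑ k ∈ Ico (j + 1) m, (1 / RX k - 1 / RX (k + 1)) * (βX k ^ n - βX j ^ n))
    (hTY : ∀ n j, TY n j = (1 - βY j ^ n) / RY m + ∑ k ∈ Ico (j + 1) m, (1 / RY k - 1 / RY (k + 1)) * (βY k ^ n - βY j ^ n))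
    (hc : 0 ≤ c) (n : ℕ) {j : ℕ} (hsj : s < j) (hj : j < m) (hβpos : 0 ≤ βY j) : TY n j ≤ TX n j := by
  obtain ⟨H, hH⟩ : ∃ H : ℕ → ℝ → ℝ → ℝ, ∀ n x y, H n x y = ∑ t ∈ range n, x ^ t * y ^ (n - 1 - t) := ⟨_, fun _ _ _ => rfl⟩
  rw [hubChain_T_persistence hρX hRX hβX hTX hH n hj, hubChain_T_persistence hρY hRY hβY hTY hH n hj]
  -- `R^Y_k ≥ R^X_k` for every `k`, `ρ` agrees at ranks `≥ j`, hence `β^Y_k ≤ β^X_k` there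
  have hRle : ∀ k, RX k ≤ RY k := by
    intro k; rw [hRX, hRY]
    refine sum_le_sum fun i _ => ?_
    by_cases his : i = s
    · rw [his]; exact htag
    · rw [hagree i his]
  have hβle : ∀ k, j ≤ k → k < m → βY k ≤ βX k := by
    intro k hjk hkm
    rw [hβX, hβY, hagree k (by omega)]
    have h := div_le_div_of_nonneg_right (hRle k) (hρY k).le
    nlinarith
  have hβYnn : ∀ k, j ≤ k → k < m → 0 ≤ βY k := fun k hjk hkm => hβpos.trans (hubChain_beta_mono hρY hmonoY hRY hβY hc hjk hkm)
  have hsum : ∑ k ∈ Ico (j + 1) m, (1 / ρY (k - 1) - 1 / ρY k) * H n (βY k) (βY (k - 1))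
      ≤ ∑ k ∈ Ico (j + 1) m, (1 / ρX (k - 1) - 1 / ρX k) * H n (βX k) (βX (k - 1)) := by
    refine sum_le_sum fun k hk => ?_
    have hk' : j + 1 ≤ k ∧ k < m := by simpa using mem_Ico.mp hk
    rw [← hagree (k - 1) (by omega), ← hagree k (by omega)]
    have hcoef : 0 ≤ 1 / ρX (k - 1) - 1 / ρX k := by
      rw [sub_nonneg]; exact one_div_le_one_div_of_le (hρX _) (hmonoX (by omega : k - 1 ≤ k))
    exact mul_le_mul_of_nonneg_left (hubChain_H_mono hH n (hβYnn k (by omega) hk'.2) (hβYnn (k - 1) (by omega) (by omega))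
      (hβle k (by omega) hk'.2) (hβle (k - 1) (by omega) (by omega))) hcoef
  have hlast : H n 1 (βY (m - 1)) ≤ H n 1 (βX (m - 1)) :=
    hubChain_H_mono hH n zero_le_one (hβYnn (m - 1) (by omega) (by omega)) le_rfl (hβle (m - 1) (by omega) (by omega))
  rw [← hagree (m - 1) (by omega)]
  have hc2 : 0 ≤ c / ρX (m - 1) := div_nonneg hc (hρX _).le
  nlinarith [mul_le_mul_of_nonneg_left hsum hc, mul_le_mul_of_nonneg_left hlast hc2]

/-- **PER-STEP DOMINATION AT DEEP TARGETS:** with the kernels, eigen-data and powers of files 1–2 for both profiles, for `i, j ≠ s` with `max(i,j) > s` and `β^Y_{max(i,j)} ≥ 0`: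
`P_Yⁿ(i,j) ≤ P_Xⁿ(i,j)` for every `n` (diagonal included). [ours] -/
theorem shallowTag_pow_le (hρX : ∀ i, 0 < ρX i) (hmonoX : Monotone ρX) (hρY : ∀ i, 0 < ρY i) (hmonoY : Monotone ρY)
    (hagree : ∀ i, i ≠ s → ρX i = ρY i) (htag : ρX s ≤ ρY s)
    (hRX : ∀ k, RX k = ∑ i ∈ range k, ρX i) (hRY : ∀ k, RY k = ∑ i ∈ range k, ρY i)
    (hPXoff : ∀ i j, i ≠ j → PX i j = c * min 1 (ρX j / ρX i)) (hPXdiag : ∀ i, PX i i = 1 - ∑ j ∈ (range m).erase i, PX i j)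
    (hPYoff : ∀ i j, i ≠ j → PY i j = c * min 1 (ρY j / ρY i)) (hPYdiag : ∀ i, PY i i = 1 - ∑ j ∈ (range m).erase i, PY i j)
    (hfX : ∀ k i, fX k i = if i < k then ρX k else if i = k then -RX k else 0) (hfY : ∀ k i, fY k i = if i < k then ρY k else if i = k then -RY k else 0)
    (hβX : ∀ k, βX k = 1 - c * (((m - k : ℕ) : ℝ) + RX k / ρX k)) (hβY : ∀ k, βY k = 1 - c * (((m - k : ℕ) : ℝ) + RY k / ρY k))
    (hPX0 : ∀ i j, PnX 0 i j = if i = j then 1 else 0) (hPXs : ∀ n i j, PnX (n + 1) i j = ∑ l ∈ range m, PnX n i l * PX l j)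
    (hPY0 : ∀ i j, PnY 0 i j = if i = j then 1 else 0) (hPYs : ∀ n i j, PnY (n + 1) i j = ∑ l ∈ range m, PnY n i l * PY l j)
    (hTX : ∀ n j, TX n j = (1 - βX j ^ n) / RX m + ∑ k ∈ Ico (j + 1) m, (1 / RX k - 1 / RX (k + 1)) * (βX k ^ n - βX j ^ n))
    (hTY : ∀ n j, TY n j = (1 - βY j ^ n) / RY m + ∑ k ∈ Ico (j + 1) m, (1 / RY k - 1 / RY (k + 1)) * (βY k ^ n - βY j ^ n))
    (hc : 0 ≤ c) (n : ℕ) {i j : ℕ} (hi : i < m) (hj : j < m) (his : i ≠ s) (hjs : j ≠ s) (hmax : s < max i j) (hβpos : 0 ≤ βY (max i j)) :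
    PnY n i j ≤ PnX n i j := by
  have hρj : ρX j = ρY j := hagree j hjs
  by_cases hij : i = j
  · subst hij
    rw [max_self] at hmax hβpos
    rw [hubChain_pow_diag hρX hmonoX hRX hPXoff hPXdiag hfX hβX hPX0 hPXs hTX n hi, hubChain_pow_diag hρY hmonoY hRY hPYoff hPYdiag hfY hβY hPY0 hPYs hTY n hi, ← hρj]
    have hT := shallowTag_T_le hρX hmonoX hρY hmonoY hagree htag hRX hRY hβX hβY hTX hTY hc n hmax hi hβpos
    -- `0 ≤ β^Y_i ≤ β^X_i`
    have hRle : RX i ≤ RY i := by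
      rw [hRX, hRY]
      refine sum_le_sum fun l _ => ?_
      by_cases hls : l = s
      · rw [hls]; exact htag
      · rw [hagree l hls]
    have hβle : βY i ≤ βX i := by
      rw [hβX, hβY, hagree i his]
      have h := div_le_div_of_nonneg_right hRle (hρY i).le
      nlinarith
    exact add_le_add (mul_le_mul_of_nonneg_left hT (hρX i).le) (pow_le_pow_left₀ hβpos hβle n)
  · rw [hubChain_pow_offdiag hρX hmonoX hRX hPXoff hPXdiag hfX hβX hPX0 hPXs hTX n hi hj hij,
      hubChain_pow_offdiag hρY hmonoY hRY hPYoff hPYdiag hfY hβY hPY0 hPYs hTY n hi hj hij, ← hρj]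
    have hmm : max i j < m := max_lt hi hj
    exact mul_le_mul_of_nonneg_left (shallowTag_T_le hρX hmonoX hρY hmonoY hagree htag hRX hRY hβX hβY hTX hTY hc n hmax hmm hβpos) (hρX j).le

end ShallowTag

end Summit.Ventures.LatticeQCDFlow.Scaling
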